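import Literature.Probability.Distributions.CharFunInversionRadialDamped
import Literature.Analysis.FunctionSpaces.UniformRandomWalkDensityInversion
import HarnessLib

/-!
# Short uniform random walks: Kluyver's density of the four-step walk, `p₄(x) = x ∫₀^∞ t J₀(xt) J₀(t)⁴ dt`

Sibling file of `Literature/Analysis/FunctionSpaces/UniformRandomWalkDensity.lean`. For `n ≥ 5`
steps the characteristic function `J₀(‖ξ‖)ⁿ` of `S_n` is integrable on the plane and Kluyver's
representation of the density was obtained by ordinary Fourier inversion
(`UniformRandomWalkDensityInversion.lean`). For `n = 4` it is NOT (`J₀⁴ ≍ r^{−2}`, the density of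
`S₄` has a logarithmic singularity at the origin, [BorweinEtAl2012, Thm. 6/eq. (4.4)]); the
inversion integral is then only Abel summable, which is the content of
`Literature/Probability/Distributions/CharFunInversionRadialDamped.lean` (hypothesis
`√r φ(r) ∈ L¹`, here `√r J₀(r)⁴ ≲ r^{−3/2}`). Consequences, all PROVED:

* `uniformWalkLaw_four_eq_withDensity` — **the law of `S₄` has the density
  `f₄(z) = (2π)⁻¹ ∫₀^∞ r J₀(r‖z‖) J₀(r)⁴ dr`** (`hankelDensity (J₀⁴)`), continuous and `≥ 0` on
  `ℂ ∖ {0}` (`continuousOn_fourStepDensity`);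
* `map_norm_uniformWalkLaw_four` — **Kluyver's formula for `n = 4`**: the law of `|S₄|` is
  `p₄(x) dx` on `(0, ∞)` with `p₄(x) = x ∫₀^∞ t J₀(xt) J₀(t)⁴ dt` [BorweinEtAl2012, eq. (2.1)]
  (`two_pi_mul_mul_hankelDensity_four`);
* `pFour_one_eq_pearsonDensityFourAtOne` — **`p₄(1) = ∫₀^∞ t J₀(t)⁵ dt = pearsonDensityFourAtOne`**,
  the number evaluated by `Literature.Analysis.FunctionSpaces.BorweinStraubWanZudilin2012_thm9`:
  the named fact is thus literally a statement about the density of the distance travelled in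
  four steps, `p₄(1)` ("`r_{5,0} = p₅'(0) = p₄(1)`", [BorweinEtAl2012, §5]);
* `hasDerivAt_pFive_zero` — **`p₅'(0) = p₄(1)`**: the density `p₅(x) = 2πx f₅(x)` of `|S₅|`
  (`map_norm_uniformWalkLaw`, `n = 5`, `f₅ = fourierDensity (uniformWalkLaw 5)` continuous) has
  derivative `2π f₅(0) = pearsonDensityFourAtOne = p₄(1)` at `x = 0` — the two readings of
  `r_{5,0}` in [BorweinEtAl2012, §5, proof of Thm. 9].

## References

* [BorweinEtAl2012] J. M. Borwein, A. Straub, J. Wan, W. Zudilin, Densities of short uniform random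
  walks, Canad. J. Math. 64 (2012) 961–990 = arXiv:1103.2995, §2 eq. (2.1), §4, §5.
* J. C. Kluyver, A local probability problem, Proc. KNAW 8 (1905) 341–350.
-/

noncomputable section

open _root_.MeasureTheory _root_.Set _root_.Real _root_.Complex _root_.Filter _root_.Metric
open scoped ENNReal
open Literature.Probability.Distributions

namespace Literature.Analysis.FunctionSpaces

/-- The radial profile `J₀⁴` is continuous. [folklore] -/
theorem continuous_besselJ_zero_pow_four : Continuous fun r : ℝ => besselJ 0 r ^ 4 :=
  (continuous_besselJ_holds 0).pow 4

/-- **`√r J₀(r)⁴ ∈ L¹(0, ∞)`** (`≤ 1` on `(0,1]`, `≤ C⁴ r^{−3/2}` on `(1,∞)` by `|J₀(r)| ≤ C r^{−1/2}`):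
hypothesis (H) of `CharFunInversionRadialDamped.lean` for the four-step walk. [folklore] -/
theorem integrableOn_sqrt_mul_besselJ_zero_pow_four :
    IntegrableOn (fun r : ℝ => Real.sqrt r * besselJ 0 r ^ 4) (Ioi 0) := by
  obtain ⟨C, -, hC⟩ := exists_abs_besselJ_zero_le_rpow
  have hcont : Continuous fun r : ℝ => Real.sqrt r * besselJ 0 r ^ 4 :=
    Real.continuous_sqrt.mul continuous_besselJ_zero_pow_four
  have h1 : IntegrableOn (fun r : ℝ => Real.sqrt r * besselJ 0 r ^ 4) (Ioc 0 1) := by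
    refine IntegrableOn.of_bound (by rw [Real.volume_Ioc]; exact ENNReal.ofReal_lt_top)
      hcont.aestronglyMeasurable 1 ?_
    filter_upwards [ae_restrict_mem measurableSet_Ioc] with r hr
    rw [norm_mul, Real.norm_of_nonneg (Real.sqrt_nonneg _), norm_pow, Real.norm_eq_abs]
    have hs : Real.sqrt r ≤ 1 := by
      have := Real.sqrt_le_sqrt hr.2
      rwa [Real.sqrt_one] at this
    have hJ : |besselJ 0 r| ^ 4 ≤ 1 := pow_le_one₀ (abs_nonneg _) (abs_besselJ_zero_le_one_holds r)
    calc Real.sqrt r * |besselJ 0 r| ^ 4 ≤ 1 * 1 :=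
          mul_le_mul hs hJ (by positivity) zero_le_one
      _ = 1 := one_mul 1
  have h2 : IntegrableOn (fun r : ℝ => Real.sqrt r * besselJ 0 r ^ 4) (Ioi 1) := by
    have hint : IntegrableOn (fun r : ℝ => C ^ 4 * r ^ (-(3 / 2 : ℝ))) (Ioi 1) :=
      (integrableOn_Ioi_rpow_of_lt (by norm_num : (-(3 / 2 : ℝ)) < -1) one_pos).const_mul _
    refine Integrable.mono' hint hcont.aestronglyMeasurable ?_
    filter_upwards [ae_restrict_mem measurableSet_Ioi] with r hr
    have hr1 : (1 : ℝ) < r := hr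
    have hr0 : 0 < r := one_pos.trans hr1
    rw [norm_mul, Real.norm_of_nonneg (Real.sqrt_nonneg _), norm_pow, Real.norm_eq_abs]
    have hJ := hC r hr0
    calc Real.sqrt r * |besselJ 0 r| ^ 4 ≤ Real.sqrt r * (C * r ^ (-(1 / 2 : ℝ))) ^ 4 := by
          gcongr
      _ = C ^ 4 * r ^ (-(3 / 2 : ℝ)) := by
          rw [mul_pow, ← Real.rpow_mul_natCast hr0.le, Real.sqrt_eq_rpow, mul_left_comm,
            ← Real.rpow_add hr0]
          norm_num
  have h := h1.union h2
  rwa [Ioc_union_Ioi_eq_Ioi zero_le_one] at h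

/-- The characteristic function of `S₄` is radial with profile `J₀⁴`. [cite: BorweinEtAl2012, §2 eq. (2.1)] -/
theorem charFun_uniformWalkLaw_four (ξ : ℂ) :
    charFun (uniformWalkLaw 4) ξ = ((besselJ 0 ‖ξ‖ ^ 4 : ℝ) : ℂ) := by
  rw [charFun_uniformWalkLaw]
  push_cast
  ring

/-- **The law of `S₄` is absolutely continuous**, with density
`f₄(z) = (2π)⁻¹ ∫₀^∞ r J₀(r‖z‖) J₀(r)⁴ dr`. [cite: BorweinEtAl2012, §2 eq. (2.1)] -/
theorem uniformWalkLaw_four_eq_withDensity :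
    uniformWalkLaw 4 =
      volume.withDensity (fun z => ENNReal.ofReal (hankelDensity (fun r => besselJ 0 r ^ 4) z)) :=
  eq_withDensity_hankelDensity charFun_uniformWalkLaw_four continuous_besselJ_zero_pow_four
    integrableOn_sqrt_mul_besselJ_zero_pow_four

/-- The density `f₄` is continuous off the origin (where it has a logarithmic singularity,
[BorweinEtAl2012, Thm. 6]). [folklore] -/
theorem continuousOn_fourStepDensity :
    ContinuousOn (hankelDensity (fun r => besselJ 0 r ^ 4)) {0}ᶜ :=
  continuousOn_hankelDensity integrableOn_sqrt_mul_besselJ_zero_pow_four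
    continuous_besselJ_zero_pow_four (fun _ _ => le_rfl)

/-- The density `f₄` is non-negative off the origin. [folklore] -/
theorem fourStepDensity_nonneg {z : ℂ} (hz : z ≠ 0) :
    0 ≤ hankelDensity (fun r => besselJ 0 r ^ 4) z :=
  hankelDensity_nonneg charFun_uniformWalkLaw_four continuous_besselJ_zero_pow_four
    integrableOn_sqrt_mul_besselJ_zero_pow_four hz

/-- **Kluyver's formula for four steps**: the law of `|S₄|` has density
`2πx f₄(x)` on `(0, ∞)`. [cite: BorweinEtAl2012, §2 eq. (2.1)] -/
theorem map_norm_uniformWalkLaw_four :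
    (uniformWalkLaw 4).map (fun z : ℂ => ‖z‖) =
      (volume.restrict (Ioi (0 : ℝ))).withDensity
        (fun x => ENNReal.ofReal (2 * π * x * hankelDensity (fun r => besselJ 0 r ^ 4) x)) :=
  map_norm_eq_withDensity_hankelDensity charFun_uniformWalkLaw_four
    continuous_besselJ_zero_pow_four integrableOn_sqrt_mul_besselJ_zero_pow_four

/-- The density of `|S₄|` in Kluyver's form: `2πx f₄(x) = x ∫₀^∞ t J₀(xt) J₀(t)⁴ dt = p₄(x)` for
`x ≥ 0`. [cite: BorweinEtAl2012, §2 eq. (2.1)] -/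
theorem two_pi_mul_mul_hankelDensity_four {x : ℝ} (hx : 0 ≤ x) :
    2 * π * x * hankelDensity (fun r => besselJ 0 r ^ 4) x =
      x * ∫ t in Ioi (0 : ℝ), t * besselJ 0 (x * t) * besselJ 0 t ^ 4 := by
  rw [hankelDensity, Complex.norm_real, Real.norm_of_nonneg hx]
  have hπ : (2 * π : ℝ) ≠ 0 := by positivity
  have h : ∫ r in Ioi (0 : ℝ), r * besselJ 0 (r * x) * besselJ 0 r ^ 4 =
      ∫ t in Ioi (0 : ℝ), t * besselJ 0 (x * t) * besselJ 0 t ^ 4 := by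
    refine setIntegral_congr_fun measurableSet_Ioi fun t _ => ?_
    rw [mul_comm t x]
  rw [h]
  field_simp

/-- **`p₄(1) = ∫₀^∞ t J₀(t)⁵ dt`**: the value at `x = 1` of Kluyver's density of `|S₄|` is the
number `pearsonDensityFourAtOne` of `UniformRandomWalkDensity.lean`, i.e. the left-hand side of
`BorweinStraubWanZudilin2012_thm9` IS `p₄(1)`. [cite: BorweinEtAl2012, §5 (proof of Thm. 9)] -/
theorem pFour_one_eq_pearsonDensityFourAtOne :
    2 * π * hankelDensity (fun r => besselJ 0 r ^ 4) 1 = pearsonDensityFourAtOne := by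
  have h := two_pi_mul_mul_hankelDensity_four zero_le_one
  rw [mul_one, one_mul, Complex.ofReal_one] at h
  rw [h, pearsonDensityFourAtOne]
  refine setIntegral_congr_fun measurableSet_Ioi fun t _ => ?_
  rw [one_mul]
  ring

/-- Leibniz at a point for `x ↦ x g(x)` with `g` merely continuous at `0`: derivative `g(0)`.
[folklore] -/
theorem hasDerivAt_id_mul_of_continuousAt {g : ℝ → ℝ} (hg : ContinuousAt g 0) :
    HasDerivAt (fun x : ℝ => x * g x) (g 0) 0 := by
  rw [hasDerivAt_iff_tendsto_slope]
  have h : ∀ x ∈ ({0}ᶜ : Set ℝ), slope (fun x : ℝ => x * g x) 0 x = g x := by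
    intro x hx
    rw [mem_compl_iff, mem_singleton_iff] at hx
    rw [slope_def_field, zero_mul, sub_zero, sub_zero, mul_div_cancel_left₀ _ hx]
  exact (tendsto_nhdsWithin_of_tendsto_nhds hg.tendsto).congr' (eventually_nhdsWithin_of_forall
    fun x hx => (h x hx).symm)

/-- **`p₅'(0) = p₄(1)`**: the density `p₅(x) = 2πx f₅(x)` of the distance after five steps
(`map_norm_uniformWalkLaw` with `n = 5`; `f₅ = fourierDensity (uniformWalkLaw 5)`, continuous by
`continuous_fourierDensity_uniformWalkLaw_five`) is differentiable at `0` with derivative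
`2π f₅(0) = ∫₀^∞ t J₀(t)⁵ dt = pearsonDensityFourAtOne = p₄(1)` — "`r_{5,0} = p₅'(0) = p₄(1)`".
[cite: BorweinEtAl2012, §5 (proof of Thm. 9)] -/
theorem hasDerivAt_pFive_zero :
    HasDerivAt (fun x : ℝ => 2 * π * x * fourierDensity (uniformWalkLaw 5) x)
      pearsonDensityFourAtOne 0 := by
  have hg : ContinuousAt (fun x : ℝ => fourierDensity (uniformWalkLaw 5) x) 0 :=
    (continuous_fourierDensity_uniformWalkLaw_five.comp Complex.continuous_ofReal).continuousAt
  have h := (hasDerivAt_id_mul_of_continuousAt hg).const_mul (2 * π)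
  rw [Complex.ofReal_zero, ← pearsonDensityFourAtOne_eq_two_pi_mul_fourierDensity] at h
  refine h.congr_of_eventuallyEq (Eventually.of_forall fun x => ?_)
  simp only
  ring

/-- Hence `p₅'(0) = p₄(1)` as numbers (`deriv` form). [cite: BorweinEtAl2012, §5 (proof of Thm. 9)] -/
theorem deriv_pFive_zero_eq_pFour_one :
    deriv (fun x : ℝ => 2 * π * x * fourierDensity (uniformWalkLaw 5) x) 0 =
      2 * π * hankelDensity (fun r => besselJ 0 r ^ 4) 1 := by
  rw [hasDerivAt_pFive_zero.deriv, pFour_one_eq_pearsonDensityFourAtOne]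


/-! ### Kluyver's density for every `n ≥ 4` -/

/-- The radial profile `J₀ⁿ` is continuous. [folklore] -/
theorem continuous_besselJ_zero_pow (n : ℕ) : Continuous fun r : ℝ => besselJ 0 r ^ n :=
  (continuous_besselJ_holds 0).pow n

/-- **`√r J₀(r)ⁿ ∈ L¹(0, ∞)` for `n ≥ 4`** (dominated by the case `n = 4` since `|J₀| ≤ 1`).
[folklore] -/
theorem integrableOn_sqrt_mul_besselJ_zero_pow {n : ℕ} (hn : 4 ≤ n) :
    IntegrableOn (fun r : ℝ => Real.sqrt r * besselJ 0 r ^ n) (Ioi 0) := by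
  refine Integrable.mono' integrableOn_sqrt_mul_besselJ_zero_pow_four
    (Real.continuous_sqrt.mul (continuous_besselJ_zero_pow n)).aestronglyMeasurable ?_
  filter_upwards [ae_restrict_mem measurableSet_Ioi] with r hr
  rw [norm_mul, Real.norm_of_nonneg (Real.sqrt_nonneg _), norm_pow, Real.norm_eq_abs]
  refine mul_le_mul_of_nonneg_left ?_ (Real.sqrt_nonneg _)
  calc |besselJ 0 r| ^ n ≤ |besselJ 0 r| ^ 4 :=
        pow_le_pow_of_le_one (abs_nonneg _) (abs_besselJ_zero_le_one_holds r) hn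
    _ = besselJ 0 r ^ 4 := by rw [← abs_pow, abs_of_nonneg (by positivity)]

/-- The characteristic function of `S_n` is radial with profile `J₀ⁿ`. [cite: BorweinEtAl2012, §2 eq. (2.1)] -/
theorem charFun_uniformWalkLaw_ofReal_pow (n : ℕ) (ξ : ℂ) :
    charFun (uniformWalkLaw n) ξ = ((besselJ 0 ‖ξ‖ ^ n : ℝ) : ℂ) := by
  rw [charFun_uniformWalkLaw]
  push_cast
  ring

/-- **The law of `S_n` is absolutely continuous for `n ≥ 4`**, with density
`f_n(z) = (2π)⁻¹ ∫₀^∞ r J₀(r‖z‖) J₀(r)ⁿ dr`. [cite: BorweinEtAl2012, §2 eq. (2.1)] -/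
theorem uniformWalkLaw_eq_withDensity_of_four_le {n : ℕ} (hn : 4 ≤ n) :
    uniformWalkLaw n =
      volume.withDensity (fun z => ENNReal.ofReal (hankelDensity (fun r => besselJ 0 r ^ n) z)) :=
  eq_withDensity_hankelDensity (charFun_uniformWalkLaw_ofReal_pow n) (continuous_besselJ_zero_pow n)
    (integrableOn_sqrt_mul_besselJ_zero_pow hn)

/-- The density `f_n` (`n ≥ 4`) is continuous off the origin. [folklore] -/
theorem continuousOn_stepDensity_of_four_le {n : ℕ} (hn : 4 ≤ n) :
    ContinuousOn (hankelDensity (fun r => besselJ 0 r ^ n)) {0}ᶜ :=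
  continuousOn_hankelDensity (integrableOn_sqrt_mul_besselJ_zero_pow hn)
    (continuous_besselJ_zero_pow n) (fun _ _ => le_rfl)

/-- The density `f_n` (`n ≥ 4`) is non-negative off the origin. [folklore] -/
theorem stepDensity_nonneg_of_four_le {n : ℕ} (hn : 4 ≤ n) {z : ℂ} (hz : z ≠ 0) :
    0 ≤ hankelDensity (fun r => besselJ 0 r ^ n) z :=
  hankelDensity_nonneg (charFun_uniformWalkLaw_ofReal_pow n) (continuous_besselJ_zero_pow n)
    (integrableOn_sqrt_mul_besselJ_zero_pow hn) hz

/-- **Kluyver's theorem** [BorweinEtAl2012, §2 eq. (2.1)]: for `n ≥ 4` the law of the distance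
`|S_n|` has the density `p_n(x) = 2πx f_n(x)` on `(0, ∞)`. [cite: BorweinEtAl2012, §2 eq. (2.1)] -/
theorem map_norm_uniformWalkLaw_of_four_le {n : ℕ} (hn : 4 ≤ n) :
    (uniformWalkLaw n).map (fun z : ℂ => ‖z‖) =
      (volume.restrict (Ioi (0 : ℝ))).withDensity
        (fun x => ENNReal.ofReal (2 * π * x * hankelDensity (fun r => besselJ 0 r ^ n) x)) :=
  map_norm_eq_withDensity_hankelDensity (charFun_uniformWalkLaw_ofReal_pow n)
    (continuous_besselJ_zero_pow n) (integrableOn_sqrt_mul_besselJ_zero_pow hn)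

/-- Kluyver's form of the density of `|S_n|`: `2πx f_n(x) = x ∫₀^∞ t J₀(xt) J₀(t)ⁿ dt = p_n(x)`
for `x ≥ 0` (any `n`). [cite: BorweinEtAl2012, §2 eq. (2.1)] -/
theorem two_pi_mul_mul_hankelDensity_pow (n : ℕ) {x : ℝ} (hx : 0 ≤ x) :
    2 * π * x * hankelDensity (fun r => besselJ 0 r ^ n) x =
      x * ∫ t in Ioi (0 : ℝ), t * besselJ 0 (x * t) * besselJ 0 t ^ n := by
  rw [hankelDensity, Complex.norm_real, Real.norm_of_nonneg hx]
  have hπ : (2 * π : ℝ) ≠ 0 := by positivity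
  have h : ∫ r in Ioi (0 : ℝ), r * besselJ 0 (r * x) * besselJ 0 r ^ n =
      ∫ t in Ioi (0 : ℝ), t * besselJ 0 (x * t) * besselJ 0 t ^ n := by
    refine setIntegral_congr_fun measurableSet_Ioi fun t _ => ?_
    rw [mul_comm t x]
  rw [h]
  field_simp

end Literature.Analysis.FunctionSpaces

end
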